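import Mathlib.Analysis.Calculus.ParametricIntegral
import Mathlib.Analysis.Calculus.ContDiff.Basic
import Mathlib.Analysis.Calculus.ContDiff.Comp
import Mathlib.Analysis.Normed.Operator.BoundedLinearMaps
import Mathlib.Analysis.Calculus.FDeriv.Mul
import Mathlib.Analysis.Matrix.Normed
import Mathlib.LinearAlgebra.Matrix.GeneralLinearGroup.Defs
import Mathlib.MeasureTheory.Function.ContinuousMapDense
import Mathlib.Topology.Algebra.Group.Compact
import HarnessLib

/-!
# Differentiating `s ↦ ∫_S f(h·c(s)·h⁻¹) dμ(h)` TWICE under the integral sign, for a `C²` matrix curve `c` and a closed matrix group `S ≤ GL_N(ℂ)` with a uniform compact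
# carrier (Folland 1995 §2.6; the calculus step of Varadarajan 1989 §6.3–6.4 «radial component of the Casimir»)

Topic `NumberTheory/Automorphic`; namespace `Literature.NumberTheory.Automorphic.ConjugationCurve`.  THEOREMS ONLY (no `def`, no instance, no notation, no axiom, no named
fact, no `sorry`).  Cell `pub/hodgecm-mathlib`, ENGINE T1 (crux H413 = `stmt-HodgeConjecture-24833`); ROAD (Z) toward the row (J3-odd)₃ = [Varadarajan1989 §6.4 Thm 24] descended
(census `CENSUS-J3odd3-InHouse.A-p18g25.md` 7db511ac, A-p18 (g25), 2026-09-01), FILE Z2 of five — the GENERIC analysis under FILE Z3's radial differential equation: Z3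
applies it (i) to the torus curve `c(ψ) = γ_ψ` (`c′ = γX₁`, `c″ = −γ`; ★ Z1 `hasDerivAt_torusCurve`) to get `O′`, `O″` under the integral, and (ii) to the boost conjugation
curves `c_k(s) = u_k(s)γu_k(−s)` (★ Z1 `hasDerivAt_conjBoost(_deriv)`), where RIGHT-INVARIANCE of `μ` makes the integral constant in `s`, so the second derivative under the
integral integrates to `0`.  Generalises the `C¹` torus-curve theorem ★ `ArchLocalTorusOrbitalDeriv` (F0P3a-p06) to arbitrary `C²` conjugating curves and one more derivative;
the compact carrier is a HYPOTHESIS here (Z3 discharges it with ★ `isCompact_setOf_exists_conj_circleDiagonal_mem` and its right-translates).  Author A-p18 (g25).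

WHAT IS PROVED (`S : Subgroup (GL (Fin N) ℂ)` with its Borel structure, `μ` finite on compacta, `E` complete, matrix norms from `open scoped Matrix.Norms.Operator`):
* §1 ABSTRACT: `hasDerivAt_integral_of_compact_carrier` — `F, F′ : ℝ → X → E` jointly continuous, `∂_s F = F′` pointwise, `F(s, ·) = 0` off ONE compact `K` for `s` in a ball
  ⇒ `F′(s₀, ·)` integrable and `d∕ds|_{s₀} ∫ F(s,x) dμ = ∫ F′(s₀,x) dμ` (Mathlib `hasDerivAt_integral_of_dominated_loc_of_deriv_le`, bound `1_K · max`).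
* §2 POINTWISE: chain rules `∂_s f(P c(s) Q) = Df(P c Q)[P c′ Q]`, `∂_s Df(P c Q)[P c′ Q] = D²f(P c Q)[P c′ Q, P c′ Q] + Df(P c Q)[P c″ Q]`; vanishing of `f`, `Df`, `D²f` off `tsupport f`;
  joint continuity in `(s, h)`.
* §3 UNDER THE INTEGRAL: **`hasDerivAt_integral_comp_conj_curve`** (`O′(s₀) = ∫ Df(hc(s₀)h⁻¹)[hc′(s₀)h⁻¹] dμ`) and **`hasDerivAt_integral_fderiv_comp_conj_curve`**
  (`(O′)′(s₀) = ∫ {D²f(hch⁻¹)[hc′h⁻¹, hc′h⁻¹] + Df(hch⁻¹)[hc″h⁻¹]} dμ`) under the single hypothesis `∀ s ∈ B̄(s₀,δ), ∀ h ∉ K, h c(s) h⁻¹ ∉ tsupport f`.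
HONEST LABEL: calculus bookkeeping; pays nothing by itself (HC_CM is proved only modulo the printed citations until rung 0 closes).

## References
* [Folland1995] G. B. Folland, *A Course in Abstract Harmonic Analysis* (1995), §2.6 (invariant integration; differentiation under Haar integrals).
* [Varadarajan1989] V. S. Varadarajan, *An Introduction to Harmonic Analysis on Semisimple Lie Groups* (1989), §6.3–§6.4 (orbital integrals along one-parameter families).
* [Rogawski1990] J. D. Rogawski, *Automorphic Representations of Unitary Groups in Three Variables*, Ann. of Math. Stud. 123 (1990), §8.2 pp. 119–123.
-/

set_option autoImplicit false

namespace Literature.NumberTheory.Automorphic.ConjugationCurve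

open MeasureTheory Set Filter Topology
open scoped Matrix.Norms.Operator MatrixGroups

/-! ## §1 Abstract: differentiation under the integral sign with ONE compact carrier -/

/-- **Differentiation under the integral sign, compact-carrier form**: `F, F′ : ℝ → X → E` jointly continuous with `∂_s F(s,x) = F′(s,x)` everywhere, and `F(s,·)`
vanishing off a fixed compact `K` for `s ∈ B(s₀, δ)`; then `F′(s₀,·)` is integrable and `s ↦ ∫ F(s,x) dμ` has derivative `∫ F′(s₀,x) dμ` at `s₀` (`μ` finite on compacta).
Dominated differentiation with the bound `1_K · max_{B̄(s₀,δ∕2) × K} ‖F′‖`; `F′` vanishes off `K` too (derivative of a locally-zero function). [cite: Folland1995, §2.6] -/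
theorem hasDerivAt_integral_of_compact_carrier {X : Type*} [TopologicalSpace X] [T2Space X] [MeasurableSpace X] [BorelSpace X]
    {E : Type*} [NormedAddCommGroup E] [NormedSpace ℝ E] [CompleteSpace E]
    (μ : Measure X) [IsFiniteMeasureOnCompacts μ] {F F' : ℝ → X → E}
    (hFd : ∀ s x, HasDerivAt (fun s => F s x) (F' s x) s) (hFc : Continuous (Function.uncurry F)) (hF'c : Continuous (Function.uncurry F'))
    {s₀ δ : ℝ} (hδ : 0 < δ) {K : Set X} (hK : IsCompact K) (hsupp : ∀ s ∈ Metric.ball s₀ δ, ∀ x ∉ K, F s x = 0) :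
    Integrable (F' s₀) μ ∧ HasDerivAt (fun s => ∫ x, F s x ∂μ) (∫ x, F' s₀ x ∂μ) s₀ := by
  -- `F′` vanishes off `K` on the open ball
  have hsupp' : ∀ s ∈ Metric.ball s₀ δ, ∀ x ∉ K, F' s x = 0 := fun s hs x hx => by
    have hev : (fun r => F r x) =ᶠ[𝓝 s] fun _ => (0 : E) := by
      filter_upwards [Metric.isOpen_ball.mem_nhds hs] with r hr using hsupp r hr x hx
    exact (hFd s x).unique ((hasDerivAt_const s (0 : E)).congr_of_eventuallyEq hev)
  -- slices are continuous with compact support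
  have hslice : ∀ s, Continuous (F s) := fun s => hFc.comp (continuous_const.prodMk continuous_id)
  have hslice' : ∀ s, Continuous (F' s) := fun s => hF'c.comp (continuous_const.prodMk continuous_id)
  have hcs : ∀ s ∈ Metric.ball s₀ δ, HasCompactSupport (F s) := fun s hs => HasCompactSupport.intro hK (hsupp s hs)
  have hcs' : ∀ s ∈ Metric.ball s₀ δ, HasCompactSupport (F' s) := fun s hs => HasCompactSupport.intro hK (hsupp' s hs)
  -- a uniform bound on `B̄(s₀, δ∕2) × K`
  obtain ⟨B, hB⟩ := ((isCompact_closedBall s₀ (δ / 2)).prod hK).exists_bound_of_continuousOn hF'c.continuousOn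
  have hhalf : Metric.ball s₀ (δ / 2) ⊆ Metric.ball s₀ δ := Metric.ball_subset_ball (by linarith)
  have h_bound : ∀ᵐ x ∂μ, ∀ s ∈ Metric.ball s₀ (δ / 2), ‖F' s x‖ ≤ K.indicator (fun _ => max B 0) x := by
    refine Eventually.of_forall fun x s hs => ?_
    by_cases hx : x ∈ K
    · rw [Set.indicator_of_mem hx]
      exact (hB (s, x) ⟨Metric.ball_subset_closedBall hs, hx⟩).trans (le_max_left _ _)
    · rw [hsupp' s (hhalf hs) x hx, norm_zero, Set.indicator_of_notMem hx]
  have hbound_int : Integrable (K.indicator fun _ => max B 0) μ :=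
    IntegrableOn.integrable_indicator (integrableOn_const (hK.measure_lt_top.ne)) hK.measurableSet
  have hs₀ : s₀ ∈ Metric.ball s₀ δ := Metric.mem_ball_self hδ
  have hF_meas : ∀ᶠ s in 𝓝 s₀, AEStronglyMeasurable (F s) μ := by
    filter_upwards [Metric.ball_mem_nhds s₀ hδ] with s hs
    exact ((hslice s).stronglyMeasurable_of_hasCompactSupport (hcs s hs)).aestronglyMeasurable
  have hF_int : Integrable (F s₀) μ := (hslice s₀).integrable_of_hasCompactSupport (hcs s₀ hs₀)
  have hF'_meas : AEStronglyMeasurable (F' s₀) μ := ((hslice' s₀).stronglyMeasurable_of_hasCompactSupport (hcs' s₀ hs₀)).aestronglyMeasurable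
  have h_diff : ∀ᵐ x ∂μ, ∀ s ∈ Metric.ball s₀ (δ / 2), HasDerivAt (fun s => F s x) (F' s x) s := Eventually.of_forall fun x s _ => hFd s x
  exact hasDerivAt_integral_of_dominated_loc_of_deriv_le (Metric.ball_mem_nhds s₀ (half_pos hδ)) hF_meas hF_int hF'_meas h_bound hbound_int h_diff

/-! ## §2 Pointwise: chain rules along `s ↦ P·c(s)·Q`, vanishing off the support, joint continuity -/

variable {N : ℕ} {E : Type*} [NormedAddCommGroup E] [NormedSpace ℝ E]

/-- `∂_s f(P c(s) Q) = Df(P c(s) Q)[P c′(s) Q]` for `f ∈ C¹`. [cite: Varadarajan1989, §6.3] -/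
theorem hasDerivAt_comp_conj_curve (f : Matrix (Fin N) (Fin N) ℂ → E) (hf : ContDiff ℝ 1 f) (P Q : Matrix (Fin N) (Fin N) ℂ)
    {c : ℝ → Matrix (Fin N) (Fin N) ℂ} {c₁ : Matrix (Fin N) (Fin N) ℂ} {s : ℝ} (hc : HasDerivAt c c₁ s) :
    HasDerivAt (fun s => f (P * c s * Q)) (fderiv ℝ f (P * c s * Q) (P * c₁ * Q)) s :=
  ((hf.differentiable one_ne_zero) _).hasFDerivAt.comp_hasDerivAt s ((hc.const_mul P).mul_const Q)

/-- `∂_s Df(P c Q)[P c′ Q] = D²f(P c Q)[P c′ Q, P c′ Q] + Df(P c Q)[P c″ Q]` for `f ∈ C²`. [cite: Varadarajan1989, §6.3] -/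
theorem hasDerivAt_fderiv_comp_conj_curve (f : Matrix (Fin N) (Fin N) ℂ → E) (hf : ContDiff ℝ 2 f) (P Q : Matrix (Fin N) (Fin N) ℂ)
    {c c₁ : ℝ → Matrix (Fin N) (Fin N) ℂ} {c₂ : Matrix (Fin N) (Fin N) ℂ} {s : ℝ} (hc : HasDerivAt c (c₁ s) s) (hc₁ : HasDerivAt c₁ c₂ s) :
    HasDerivAt (fun s => fderiv ℝ f (P * c s * Q) (P * c₁ s * Q))
      (fderiv ℝ (fderiv ℝ f) (P * c s * Q) (P * c₁ s * Q) (P * c₁ s * Q) + fderiv ℝ f (P * c s * Q) (P * c₂ * Q)) s := by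
  have hf1 := hf.fderiv_right (m := 1) (by norm_num)
  have h1 : HasDerivAt (fun s => fderiv ℝ f (P * c s * Q)) (fderiv ℝ (fderiv ℝ f) (P * c s * Q) (P * c₁ s * Q)) s :=
    ((hf1.differentiable one_ne_zero) _).hasFDerivAt.comp_hasDerivAt s ((hc.const_mul P).mul_const Q)
  have h2 : HasDerivAt (fun s => P * c₁ s * Q) (P * c₂ * Q) s := (hc₁.const_mul P).mul_const Q
  exact h1.clm_apply h2

/-- Off the support everything vanishes: `Y ∉ tsupport f ⇒ f Y = 0`, `Df(Y) = 0`, `D²f(Y) = 0`. [cite: Folland1995, §2.6] -/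
theorem eq_zero_of_notMem_tsupport (f : Matrix (Fin N) (Fin N) ℂ → E) {Y : Matrix (Fin N) (Fin N) ℂ} (hY : Y ∉ tsupport f) :
    f Y = 0 ∧ fderiv ℝ f Y = 0 ∧ fderiv ℝ (fderiv ℝ f) Y = 0 := by
  refine ⟨image_eq_zero_of_notMem_tsupport hY, fderiv_of_notMem_tsupport ℝ hY, fderiv_of_notMem_tsupport ℝ fun h => hY (tsupport_fderiv_subset ℝ h)⟩

omit [NormedSpace ℝ E] in
/-- Joint continuity of `(s, h) ↦ f(↑h·c(s)·↑h⁻¹)` on `ℝ × S`. [cite: Folland1995, §2.6] -/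
theorem continuous_comp_conj_curve (S : Subgroup (GL (Fin N) ℂ)) (f : Matrix (Fin N) (Fin N) ℂ → E) (hf : Continuous f)
    {c : ℝ → Matrix (Fin N) (Fin N) ℂ} (hc : Continuous c) :
    Continuous fun p : ℝ × S => f (((p.2 : GL (Fin N) ℂ) : Matrix (Fin N) (Fin N) ℂ) * c p.1 * (((p.2⁻¹ : S) : GL (Fin N) ℂ) : Matrix (Fin N) (Fin N) ℂ)) :=
  hf.comp ((((Units.continuous_val.comp continuous_subtype_val).comp continuous_snd).mul (hc.comp continuous_fst)).mul
    ((Units.continuous_val.comp continuous_subtype_val).comp continuous_snd.inv))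

/-- Joint continuity of `(s, h) ↦ Df(↑h·c(s)·↑h⁻¹)[↑h·c′(s)·↑h⁻¹]`. [cite: Folland1995, §2.6] -/
theorem continuous_fderiv_comp_conj_curve (S : Subgroup (GL (Fin N) ℂ)) (f : Matrix (Fin N) (Fin N) ℂ → E) (hf : ContDiff ℝ 1 f)
    {c c₁ : ℝ → Matrix (Fin N) (Fin N) ℂ} (hc : Continuous c) (hc₁ : Continuous c₁) :
    Continuous fun p : ℝ × S => fderiv ℝ f (((p.2 : GL (Fin N) ℂ) : Matrix (Fin N) (Fin N) ℂ) * c p.1 * (((p.2⁻¹ : S) : GL (Fin N) ℂ) : Matrix (Fin N) (Fin N) ℂ))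
      (((p.2 : GL (Fin N) ℂ) : Matrix (Fin N) (Fin N) ℂ) * c₁ p.1 * (((p.2⁻¹ : S) : GL (Fin N) ℂ) : Matrix (Fin N) (Fin N) ℂ)) := by
  have hg : Continuous fun p : ℝ × S => ((p.2 : GL (Fin N) ℂ) : Matrix (Fin N) (Fin N) ℂ) := (Units.continuous_val.comp continuous_subtype_val).comp continuous_snd
  have hgi : Continuous fun p : ℝ × S => (((p.2⁻¹ : S) : GL (Fin N) ℂ) : Matrix (Fin N) (Fin N) ℂ) :=
    (Units.continuous_val.comp continuous_subtype_val).comp continuous_snd.inv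
  exact ((hf.continuous_fderiv one_ne_zero).comp ((hg.mul (hc.comp continuous_fst)).mul hgi)).clm_apply ((hg.mul (hc₁.comp continuous_fst)).mul hgi)

/-- Joint continuity of `(s, h) ↦ D²f(↑h·c·↑h⁻¹)[↑h·c′·↑h⁻¹, ↑h·c′·↑h⁻¹] + Df(↑h·c·↑h⁻¹)[↑h·c″·↑h⁻¹]`. [cite: Folland1995, §2.6] -/
theorem continuous_fderiv_fderiv_comp_conj_curve (S : Subgroup (GL (Fin N) ℂ)) (f : Matrix (Fin N) (Fin N) ℂ → E) (hf : ContDiff ℝ 2 f)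
    {c c₁ c₂ : ℝ → Matrix (Fin N) (Fin N) ℂ} (hc : Continuous c) (hc₁ : Continuous c₁) (hc₂ : Continuous c₂) :
    Continuous fun p : ℝ × S =>
      fderiv ℝ (fderiv ℝ f) (((p.2 : GL (Fin N) ℂ) : Matrix (Fin N) (Fin N) ℂ) * c p.1 * (((p.2⁻¹ : S) : GL (Fin N) ℂ) : Matrix (Fin N) (Fin N) ℂ))
          (((p.2 : GL (Fin N) ℂ) : Matrix (Fin N) (Fin N) ℂ) * c₁ p.1 * (((p.2⁻¹ : S) : GL (Fin N) ℂ) : Matrix (Fin N) (Fin N) ℂ))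
          (((p.2 : GL (Fin N) ℂ) : Matrix (Fin N) (Fin N) ℂ) * c₁ p.1 * (((p.2⁻¹ : S) : GL (Fin N) ℂ) : Matrix (Fin N) (Fin N) ℂ)) +
        fderiv ℝ f (((p.2 : GL (Fin N) ℂ) : Matrix (Fin N) (Fin N) ℂ) * c p.1 * (((p.2⁻¹ : S) : GL (Fin N) ℂ) : Matrix (Fin N) (Fin N) ℂ))
          (((p.2 : GL (Fin N) ℂ) : Matrix (Fin N) (Fin N) ℂ) * c₂ p.1 * (((p.2⁻¹ : S) : GL (Fin N) ℂ) : Matrix (Fin N) (Fin N) ℂ)) := by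
  have hg : Continuous fun p : ℝ × S => ((p.2 : GL (Fin N) ℂ) : Matrix (Fin N) (Fin N) ℂ) := (Units.continuous_val.comp continuous_subtype_val).comp continuous_snd
  have hgi : Continuous fun p : ℝ × S => (((p.2⁻¹ : S) : GL (Fin N) ℂ) : Matrix (Fin N) (Fin N) ℂ) :=
    (Units.continuous_val.comp continuous_subtype_val).comp continuous_snd.inv
  have hY := (hg.mul (hc.comp continuous_fst)).mul hgi
  have hV := (hg.mul (hc₁.comp continuous_fst)).mul hgi
  have hW := (hg.mul (hc₂.comp continuous_fst)).mul hgi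
  have hf1 := hf.fderiv_right (m := 1) (by norm_num)
  have h2 : Continuous (fderiv ℝ (fderiv ℝ f)) := hf1.continuous_fderiv one_ne_zero
  exact (((h2.comp hY).clm_apply hV).clm_apply hV).add (((hf.continuous_fderiv two_ne_zero).comp hY).clm_apply hW)

/-! ## §3 Under the integral sign: the first and the second `s`-derivative of `∫_S f(h c(s) h⁻¹) dμ(h)` -/

variable [CompleteSpace E]

/-- **`d∕ds|_{s₀} ∫_S f(h c(s) h⁻¹) dμ = ∫_S Df(h c(s₀) h⁻¹)[h c′(s₀) h⁻¹] dμ`** (and the latter integrand is integrable), for `f ∈ C¹(M_N(ℂ))`, a `C¹` curve `c` with continuous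
derivative `c′`, `μ` finite on compacta, provided ONE compact `K ⊆ S` carries the integrand for `s ∈ B̄(s₀, δ)`: `h ∉ K ⇒ h c(s) h⁻¹ ∉ tsupport f`.
[cite: Folland1995, §2.6] [cite: Varadarajan1989, §6.3] -/
theorem hasDerivAt_integral_comp_conj_curve (S : Subgroup (GL (Fin N) ℂ)) [MeasurableSpace S] [BorelSpace S] (μ : Measure S) [IsFiniteMeasureOnCompacts μ]
    (f : Matrix (Fin N) (Fin N) ℂ → E) (hf : ContDiff ℝ 1 f) {c c₁ : ℝ → Matrix (Fin N) (Fin N) ℂ} (hc : ∀ s, HasDerivAt c (c₁ s) s) (hc₁ : Continuous c₁)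
    {s₀ δ : ℝ} (hδ : 0 < δ) {K : Set S} (hK : IsCompact K)
    (hsupp : ∀ s ∈ Metric.ball s₀ δ, ∀ h : S, h ∉ K →
      ((h : GL (Fin N) ℂ) : Matrix (Fin N) (Fin N) ℂ) * c s * (((h⁻¹ : S) : GL (Fin N) ℂ) : Matrix (Fin N) (Fin N) ℂ) ∉ tsupport f) :
    Integrable (fun h : S => fderiv ℝ f (((h : GL (Fin N) ℂ) : Matrix (Fin N) (Fin N) ℂ) * c s₀ * (((h⁻¹ : S) : GL (Fin N) ℂ) : Matrix (Fin N) (Fin N) ℂ))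
        (((h : GL (Fin N) ℂ) : Matrix (Fin N) (Fin N) ℂ) * c₁ s₀ * (((h⁻¹ : S) : GL (Fin N) ℂ) : Matrix (Fin N) (Fin N) ℂ))) μ ∧
      HasDerivAt (fun s => ∫ h : S, f (((h : GL (Fin N) ℂ) : Matrix (Fin N) (Fin N) ℂ) * c s * (((h⁻¹ : S) : GL (Fin N) ℂ) : Matrix (Fin N) (Fin N) ℂ)) ∂μ)
        (∫ h : S, fderiv ℝ f (((h : GL (Fin N) ℂ) : Matrix (Fin N) (Fin N) ℂ) * c s₀ * (((h⁻¹ : S) : GL (Fin N) ℂ) : Matrix (Fin N) (Fin N) ℂ))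
          (((h : GL (Fin N) ℂ) : Matrix (Fin N) (Fin N) ℂ) * c₁ s₀ * (((h⁻¹ : S) : GL (Fin N) ℂ) : Matrix (Fin N) (Fin N) ℂ)) ∂μ) s₀ := by
  have hcc : Continuous c := continuous_iff_continuousAt.2 fun s => (hc s).continuousAt
  refine hasDerivAt_integral_of_compact_carrier μ (F := fun s (h : S) => f (((h : GL (Fin N) ℂ) : Matrix (Fin N) (Fin N) ℂ) * c s *
      (((h⁻¹ : S) : GL (Fin N) ℂ) : Matrix (Fin N) (Fin N) ℂ))) (fun s h => hasDerivAt_comp_conj_curve f hf _ _ (hc s))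
    (continuous_comp_conj_curve S f hf.continuous hcc) (continuous_fderiv_comp_conj_curve S f hf hcc hc₁) hδ hK fun s hs h hh => ?_
  exact (eq_zero_of_notMem_tsupport f (hsupp s hs h hh)).1

/-- **`d∕ds|_{s₀} ∫_S Df(h c h⁻¹)[h c′ h⁻¹] dμ = ∫_S {D²f(h c h⁻¹)[h c′ h⁻¹, h c′ h⁻¹] + Df(h c h⁻¹)[h c″ h⁻¹]}(s₀) dμ`** — the second derivative under the integral sign, for
`f ∈ C²`, a `C²` curve (`c′ = c₁`, `c₁′ = c₂`, `c₂` continuous) and the same compact carrier. [cite: Folland1995, §2.6] [cite: Varadarajan1989, §6.3] -/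
theorem hasDerivAt_integral_fderiv_comp_conj_curve (S : Subgroup (GL (Fin N) ℂ)) [MeasurableSpace S] [BorelSpace S] (μ : Measure S) [IsFiniteMeasureOnCompacts μ]
    (f : Matrix (Fin N) (Fin N) ℂ → E) (hf : ContDiff ℝ 2 f) {c c₁ c₂ : ℝ → Matrix (Fin N) (Fin N) ℂ} (hc : ∀ s, HasDerivAt c (c₁ s) s)
    (hc₁ : ∀ s, HasDerivAt c₁ (c₂ s) s) (hc₂ : Continuous c₂)
    {s₀ δ : ℝ} (hδ : 0 < δ) {K : Set S} (hK : IsCompact K)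
    (hsupp : ∀ s ∈ Metric.ball s₀ δ, ∀ h : S, h ∉ K →
      ((h : GL (Fin N) ℂ) : Matrix (Fin N) (Fin N) ℂ) * c s * (((h⁻¹ : S) : GL (Fin N) ℂ) : Matrix (Fin N) (Fin N) ℂ) ∉ tsupport f) :
    Integrable (fun h : S =>
        fderiv ℝ (fderiv ℝ f) (((h : GL (Fin N) ℂ) : Matrix (Fin N) (Fin N) ℂ) * c s₀ * (((h⁻¹ : S) : GL (Fin N) ℂ) : Matrix (Fin N) (Fin N) ℂ))
            (((h : GL (Fin N) ℂ) : Matrix (Fin N) (Fin N) ℂ) * c₁ s₀ * (((h⁻¹ : S) : GL (Fin N) ℂ) : Matrix (Fin N) (Fin N) ℂ))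
            (((h : GL (Fin N) ℂ) : Matrix (Fin N) (Fin N) ℂ) * c₁ s₀ * (((h⁻¹ : S) : GL (Fin N) ℂ) : Matrix (Fin N) (Fin N) ℂ)) +
          fderiv ℝ f (((h : GL (Fin N) ℂ) : Matrix (Fin N) (Fin N) ℂ) * c s₀ * (((h⁻¹ : S) : GL (Fin N) ℂ) : Matrix (Fin N) (Fin N) ℂ))
            (((h : GL (Fin N) ℂ) : Matrix (Fin N) (Fin N) ℂ) * c₂ s₀ * (((h⁻¹ : S) : GL (Fin N) ℂ) : Matrix (Fin N) (Fin N) ℂ))) μ ∧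
      HasDerivAt (fun s => ∫ h : S, fderiv ℝ f (((h : GL (Fin N) ℂ) : Matrix (Fin N) (Fin N) ℂ) * c s * (((h⁻¹ : S) : GL (Fin N) ℂ) : Matrix (Fin N) (Fin N) ℂ))
          (((h : GL (Fin N) ℂ) : Matrix (Fin N) (Fin N) ℂ) * c₁ s * (((h⁻¹ : S) : GL (Fin N) ℂ) : Matrix (Fin N) (Fin N) ℂ)) ∂μ)
        (∫ h : S, (fderiv ℝ (fderiv ℝ f) (((h : GL (Fin N) ℂ) : Matrix (Fin N) (Fin N) ℂ) * c s₀ * (((h⁻¹ : S) : GL (Fin N) ℂ) : Matrix (Fin N) (Fin N) ℂ))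
            (((h : GL (Fin N) ℂ) : Matrix (Fin N) (Fin N) ℂ) * c₁ s₀ * (((h⁻¹ : S) : GL (Fin N) ℂ) : Matrix (Fin N) (Fin N) ℂ))
            (((h : GL (Fin N) ℂ) : Matrix (Fin N) (Fin N) ℂ) * c₁ s₀ * (((h⁻¹ : S) : GL (Fin N) ℂ) : Matrix (Fin N) (Fin N) ℂ)) +
          fderiv ℝ f (((h : GL (Fin N) ℂ) : Matrix (Fin N) (Fin N) ℂ) * c s₀ * (((h⁻¹ : S) : GL (Fin N) ℂ) : Matrix (Fin N) (Fin N) ℂ))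
            (((h : GL (Fin N) ℂ) : Matrix (Fin N) (Fin N) ℂ) * c₂ s₀ * (((h⁻¹ : S) : GL (Fin N) ℂ) : Matrix (Fin N) (Fin N) ℂ))) ∂μ) s₀ := by
  have hcc : Continuous c := continuous_iff_continuousAt.2 fun s => (hc s).continuousAt
  have hcc₁ : Continuous c₁ := continuous_iff_continuousAt.2 fun s => (hc₁ s).continuousAt
  refine hasDerivAt_integral_of_compact_carrier μ
    (F := fun s (h : S) => fderiv ℝ f (((h : GL (Fin N) ℂ) : Matrix (Fin N) (Fin N) ℂ) * c s * (((h⁻¹ : S) : GL (Fin N) ℂ) : Matrix (Fin N) (Fin N) ℂ))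
      (((h : GL (Fin N) ℂ) : Matrix (Fin N) (Fin N) ℂ) * c₁ s * (((h⁻¹ : S) : GL (Fin N) ℂ) : Matrix (Fin N) (Fin N) ℂ)))
    (fun s h => hasDerivAt_fderiv_comp_conj_curve f hf _ _ (hc s) (hc₁ s))
    (continuous_fderiv_comp_conj_curve S f (hf.of_le (by norm_num)) hcc hcc₁) (continuous_fderiv_fderiv_comp_conj_curve S f hf hcc hcc₁ hc₂) hδ hK
    fun s hs h hh => ?_
  rw [(eq_zero_of_notMem_tsupport f (hsupp s hs h hh)).2.1]; rfl

end Literature.NumberTheory.Automorphic.ConjugationCurve
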